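import Summits.KontsevichZagierPeriods.KontsevichZagierPeriods.Theorems.SoloInformedKZPOneKArea
import HarnessLib
import HarnessLib.Audit

/-!
# SoloInformed — the `K`-rational class phrased with real polynomials having algebraic coefficients

Solo programme `solo-KontsevichZagierPeriods-informed`, session s112, file 22.

Usability bridge for the headline theorem of file 18: a representation `r = [D, f]` of dimension `1`
whose integrand is `N(x)/M(x)` on `D` for REAL polynomials `N, M ∈ ℝ[X]` all of whose coefficients
are algebraic over `ℚ`, with `M ≠ 0` on `D`, belongs to the class `SoloInformedIsKRationalOne`
(`soloInformed_isKRationalOne_of_real`: lift `N, M` to `K[X]`, `K = algebraicClosure ℚ ℝ`, by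
`Polynomial.lifts_iff_coeff_lifts`).  Headline restatement: `soloInformed_kzp_realAlgCoeff` — two
absolutely convergent integrals `∫_D N/M dx`, `∫_{D'} N'/M' dx` of this kind with the same value are
connected by the three Kontsevich–Zagier moves.

References: M. Kontsevich, D. Zagier, *Periods* (2001), §1.1–1.2; A. Baker (1975), Thm. 2.1.
-/

noncomputable section

open scoped BigOperators Polynomial

namespace Summit.KontsevichZagierPeriods.KontsevichZagierPeriods.Theorems

open Set MeasureTheory
open Literature.ModelTheory.ExponentialFields
open Literature.NumberTheory.Transcendental Literature.NumberTheory.Transcendental.KZ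

/-- A real polynomial with algebraic coefficients lifts to `K[X]`, `K = algebraicClosure ℚ ℝ`, with
the same values. -/
theorem soloInformed_exists_lift_K (N : ℝ[X]) (hN : ∀ n, IsAlgebraic ℚ (N.coeff n)) :
    ∃ P : (algebraicClosure ℚ ℝ)[X], P.map (algebraMap (algebraicClosure ℚ ℝ) ℝ) = N ∧
      ∀ t : ℝ, (Polynomial.aeval t P : ℝ) = N.eval t := by
  have hl : N ∈ Polynomial.lifts (algebraMap (algebraicClosure ℚ ℝ) ℝ) := by
    rw [Polynomial.lifts_iff_coeff_lifts]
    intro n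
    exact ⟨⟨N.coeff n, mem_algebraicClosure_iff.2 (hN n)⟩, rfl⟩
  obtain ⟨P, hP⟩ := (Polynomial.mem_lifts _).1 hl
  refine ⟨P, hP, fun t => ?_⟩
  rw [Polynomial.aeval_def, ← Polynomial.eval_map, hP]

/-- **Real polynomials with algebraic coefficients give members of the `K`-rational class.** -/
theorem soloInformed_isKRationalOne_of_real (r : IntegralRep 1) (N M : ℝ[X])
    (hN : ∀ n, IsAlgebraic ℚ (N.coeff n)) (hM : ∀ n, IsAlgebraic ℚ (M.coeff n))
    (hq : ∀ x ∈ r.domain, M.eval (x 0) ≠ 0)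
    (hpq : EqOn r.integrand (fun x => N.eval (x 0) / M.eval (x 0)) r.domain) :
    SoloInformedIsKRationalOne r := by
  obtain ⟨P, -, hP⟩ := soloInformed_exists_lift_K N hN
  obtain ⟨Q, -, hQ⟩ := soloInformed_exists_lift_K M hM
  refine ⟨P, Q, fun x hx => by rw [hQ]; exact hq x hx, fun x hx => ?_⟩
  rw [hpq hx]
  show N.eval (x 0) / M.eval (x 0) = (Polynomial.aeval (x 0) P : ℝ) / Polynomial.aeval (x 0) Q
  rw [hP, hQ]

/-- **The Kontsevich–Zagier period conjecture for one-variable rational integrands with real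
algebraic coefficients** (headline form).  Let `r = [D, f]`, `r' = [D', f']` be integral
representations of dimension `1` (so `D, D' ⊆ ℝ` are `ℚ`-semialgebraic and the integrals converge
absolutely) with `f = N/M` on `D`, `f' = N'/M'` on `D'` for real polynomials `N, M, N', M'` with
algebraic coefficients, `M ≠ 0` on `D`, `M' ≠ 0` on `D'`.  If `∫_D f = ∫_{D'} f'` then `r` and `r'` are
connected by a finite chain of the three Kontsevich–Zagier moves (additivity, change of variables,
Newton–Leibniz). [Kontsevich–Zagier 2001, §1.2 Question 1, one-variable rational case with algebraic
coefficients; Baker 1975, Thm. 2.1; this work] -/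
theorem soloInformed_kzp_realAlgCoeff (r r' : IntegralRep 1) (N M N' M' : ℝ[X])
    (hN : ∀ n, IsAlgebraic ℚ (N.coeff n)) (hM : ∀ n, IsAlgebraic ℚ (M.coeff n))
    (hN' : ∀ n, IsAlgebraic ℚ (N'.coeff n)) (hM' : ∀ n, IsAlgebraic ℚ (M'.coeff n))
    (hq : ∀ x ∈ r.domain, M.eval (x 0) ≠ 0) (hq' : ∀ x ∈ r'.domain, M'.eval (x 0) ≠ 0)
    (hpq : EqOn r.integrand (fun x => N.eval (x 0) / M.eval (x 0)) r.domain)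
    (hpq' : EqOn r'.integrand (fun x => N'.eval (x 0) / M'.eval (x 0)) r'.domain)
    (hv : r.value = r'.value) : Equivalent r r' :=
  (soloInformed_kzp_isKRationalOne r r' (soloInformed_isKRationalOne_of_real r N M hN hM hq hpq)
    (soloInformed_isKRationalOne_of_real r' N' M' hN' hM' hq' hpq')).1 hv

/-- Kernel form, headline version: `∫_D N/M = 0` ⇒ `[D, N/M] ∈ relations`. -/
theorem soloInformed_mem_relations_of_value_eq_zero_realAlgCoeff (r : IntegralRep 1) (N M : ℝ[X])
    (hN : ∀ n, IsAlgebraic ℚ (N.coeff n)) (hM : ∀ n, IsAlgebraic ℚ (M.coeff n))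
    (hq : ∀ x ∈ r.domain, M.eval (x 0) ≠ 0)
    (hpq : EqOn r.integrand (fun x => N.eval (x 0) / M.eval (x 0)) r.domain)
    (h0 : r.value = 0) : of r ∈ relations :=
  soloInformed_mem_relations_of_value_eq_zero_K r
    (soloInformed_isKRationalOne_of_real r N M hN hM hq hpq) h0

end Summit.KontsevichZagierPeriods.KontsevichZagierPeriods.Theorems
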